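import Literature.Geometry.Kaehler.ComplexTorusLoopWindings
import Literature.AlgebraicTopology.SingularHomology.CohomologyHomotopyInvariance
import HarnessLib

/-!
# Torsion readings are locally constant in a trivialised family of torus-charted fibres

Layer `Literature/Geometry/Kaehler`, namespace `Literature.Geometry.Kaehler.ComplexTorus`.  THEOREMS ONLY (no definition, no
named fact, no instance).  Generic topological leaf (E2) of the cell `hodgecm-mathlib` (U)-lane node U-e, engine (E2-core)
«torsion readings against a flat frame are constant» (road (b-H′): markings built pointwise, only DISCRETE data transported).

SETTING (pure topology).  `p : E → B` is a continuous family TRIVIALISED by `triv : B × F ≃ₜ E` over a path-connected base `B`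
(an Ehresmann chart); every fibre `p⁻¹(x)` is CHARTED by a torus: `u x : T = (ℝ/ℤ)^ι → E` continuous, injective, onto `p⁻¹(x)`
(a pointwise uniformisation — NO continuity in `x` is assumed); a continuous self-map `nE` of `E` is «multiplication by `N`» in
every chart (`nE (u x t) = u x (N • t)`); the charts' canonical classes come from GLOBAL classes `Ξₐ ∈ H¹(E; R)` (`R ⊇ ℤ`, e.g. `ℚ`, `ℂ`)
(`(u x)^* Ξₐ = ξₐ` for every `x` — the FLAT FRAME condition: in the application `Ξₐ` is the tube class of a flat integral frame and
`u x` the marking's uniformisation, ★ `SiegelMarkingFamily.IsMarkingFrame`); the zero section `z x = u x 0` is continuous; and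
`τ` is a continuous section which in the chart at `x` is the `N`-torsion point `[w(x)/N]`, `w(x) ∈ ℤ^ι`.

THEOREM `torsionReading_eq_of_trivialisation`: **`w(x) ≡ w(x′) (mod N)` for all `x, x′ ∈ B`** — the lattice readings of a
continuous torsion section against a flat frame are constant.

Proof («only discrete data transported»).  Near `x₁`, join the zero section to `τ` by fibrewise paths `P_x` varying
continuously in `x` (straight lines in local torus coordinates of the `x₁`-fibre, `exists_nhds_pathFamily`), and form the loops
`L_x = nE ∘ P_x` at `z(x)`.  Read in the chart `u x`, `L_x = N • q_x` for a path `q_x` from `0` to `[w(x)/N]`, so its `a`-th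
winding is `≡ w(x)ₐ (mod N)` (★ `windingCochain_nsmul_path_of_torsion`); read in the torus coordinates of the `x₁`-fibre
transported by `triv`, the loops form a continuous family, so their windings are locally constant (★
`exists_nhds_windingCochain_eq`); the two readings agree because the two charts of `p⁻¹(x)` — `u x` and «`triv`-transport of
`u x₁`» — pull `Ξₐ` back to the same class (they are homotopic through the fibres along a path `x₁ ⇝ x`, ★
`singularCohomology.map_eq_of_homotopic_holds`, and `⟨·, h(loop)⟩` is natural, ★ `kroneckerPairing_map`).
HC_CM is proved only modulo the 7 printed citations until rung 0 closes.

## References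
* [VoisinHodgeI2002] C. Voisin, *Hodge Theory and Complex Algebraic Geometry I*, CUP 2002, §9.1.1 Thm. 9.3 (Ehresmann) and
  §9.2.1 (local systems), pp. 220–231.
* [HatcherAT2002] A. Hatcher, *Algebraic Topology*, CUP 2002, Prop. 1.30 (p. 60), §3.1 p. 198 and p. 201.
* [Lange2023AbelianVarietiesComplex] H. Lange, *Abelian Varieties over the Complex Numbers* (2023), §1.1.3 (pp. 13–14), Lemma 1.1.17 (a) (p. 14).
* [LangeBirkenhake1992] H. Lange, Ch. Birkenhake, *Complex Abelian Varieties* (1992), Ch. 8 §8.1.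
-/

noncomputable section

open Set Function unitInterval Topology Filter
open Literature.AlgebraicTopology.SingularHomology Literature.AlgebraicTopology.SingularHomology.SingularSimplex
open Literature.AlgebraicGeometry.HodgeTheory (latticeClass latticeCircle)

namespace Literature.Geometry.Kaehler

namespace ComplexTorus

variable {ι : Type} [Fintype ι] {V : Type} [NormedAddCommGroup V] [NormedSpace ℂ V] (Φ : (ι → ℝ) ≃L[ℝ] V)

/-! ### Local continuous lifts through `ℝ^ι → (ℝ/ℤ)^ι` -/

omit [Fintype ι] in
/-- The quotient map `ℝ^ι → (ℝ/ℤ)^ι` is additive: `proj (y − y') = proj y − proj y'`. [cite: Lange2023AbelianVarietiesComplex, §1.1.3 (pp. 13–14)] -/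
theorem proj_sub (y y' : ι → ℝ) : proj Φ (y - y') = proj Φ y - proj Φ y' := by
  funext i
  simp only [proj_apply, Pi.sub_apply, AddCircle.coe_sub]
  rfl

/-- **A continuous local section of `ℝ^ι → (ℝ/ℤ)^ι` around any point** `c`: lift `t − c` coordinatewise into `[−½, ½)` (continuous
off the antipodes) and add a representative of `c`. [cite: HatcherAT2002, Prop. 1.30 (p. 60)] -/
theorem exists_nhds_continuousOn_lift (c : ComplexTorus Φ) :
    ∃ U : Set (ComplexTorus Φ), IsOpen U ∧ c ∈ U ∧ ∃ s : ComplexTorus Φ → (ι → ℝ), ContinuousOn s U ∧ ∀ t, proj Φ (s t) = t := by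
  haveI : Fact ((0 : ℝ) < 1) := ⟨one_pos⟩
  -- the antipodal value `[−½]` and the open set where no coordinate of `t − c` hits it
  set q : AddCircle (1 : ℝ) := ((-(1 / 2 : ℝ) : ℝ) : AddCircle (1 : ℝ)) with hq
  refine ⟨{t | ∀ i, latticeCircle Φ i (t - c) ≠ q}, ?_, ?_, ?_⟩
  · rw [Set.setOf_forall]
    exact isOpen_iInter_of_finite fun i ↦
      isOpen_ne_fun ((latticeCircle Φ i).continuous.comp (continuous_id.sub continuous_const)) continuous_const
  · intro i
    rw [sub_self]
    change (0 : AddCircle (1 : ℝ)) ≠ q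
    rw [hq, ne_comm, Ne, AddCircle.coe_eq_zero_iff]
    rintro ⟨n, hn⟩
    rw [zsmul_eq_mul, mul_one] at hn
    have h2 : (2 : ℝ) * n = -1 := by linarith
    have h3 : (2 * n : ℤ) = -1 := by exact_mod_cast h2
    omega
  · refine ⟨fun t i ↦ circleRep (c i) + ((AddCircle.equivIco (1 : ℝ) (-(1 / 2 : ℝ)) (latticeCircle Φ i (t - c)) : ℝ)),
      ?_, ?_⟩
    · refine continuousOn_pi.2 fun i ↦ continuousOn_const.add ?_
      refine continuous_subtype_val.comp_continuousOn ?_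
      intro t ht
      have hf : ContinuousAt (fun t : ComplexTorus Φ ↦ latticeCircle Φ i (t - c)) t :=
        ((latticeCircle Φ i).continuous.comp (continuous_id.sub continuous_const)).continuousAt
      exact (ContinuousAt.comp (f := fun t : ComplexTorus Φ ↦ latticeCircle Φ i (t - c))
        (AddCircle.continuousAt_equivIco (p := (1 : ℝ)) (a := -(1 / 2 : ℝ)) (ht i)) hf).continuousWithinAt
    · intro t
      funext i
      rw [proj_apply, AddCircle.coe_add, coe_circleRep]
      have h : (((AddCircle.equivIco (1 : ℝ) (-(1 / 2 : ℝ)) (latticeCircle Φ i (t - c)) : ℝ)) : AddCircle (1 : ℝ)) =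
          latticeCircle Φ i (t - c) :=
        (AddCircle.equivIco (1 : ℝ) (-(1 / 2 : ℝ))).symm_apply_apply _
      rw [h]
      change c i + (t i - c i) = t i
      abel

/-! ### Continuous families of paths between two continuous families of points -/

variable {B : Type} [TopologicalSpace B]

/-- **Continuous families of paths in the torus.**  Given continuous `α β : B → (ℝ/ℤ)^ι` and `x₁ ∈ B`, on an open neighbourhood
`B₁ ∋ x₁` there is a jointly continuous family of paths `P_x` from `α x` to `β x` (`x ∈ B₁`): a fixed path `α x₁ ⇝ β x₁` translated by
the straight segment between local lifts of `α x − α x₁` and `β x − β x₁`. [cite: HatcherAT2002, Prop. 1.30 (p. 60)] -/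
theorem exists_nhds_pathFamily (α β : C(B, ComplexTorus Φ)) (x₁ : B) :
    ∃ B₁ : Set B, IsOpen B₁ ∧ x₁ ∈ B₁ ∧ ∃ P : C(↥B₁ × unitInterval, ComplexTorus Φ),
      (∀ x, P (x, 0) = α x) ∧ ∀ x, P (x, 1) = β x := by
  obtain ⟨Uα, hUαo, hcα, sα, hsα, hpsα⟩ := exists_nhds_continuousOn_lift Φ (α x₁)
  obtain ⟨Uβ, hUβo, hcβ, sβ, hsβ, hpsβ⟩ := exists_nhds_continuousOn_lift Φ (β x₁)
  refine ⟨α ⁻¹' Uα ∩ β ⁻¹' Uβ, (hUαo.preimage α.continuous).inter (hUβo.preimage β.continuous), ⟨hcα, hcβ⟩, ?_⟩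
  set q₀ : Path (α x₁) (β x₁) := PathConnectedSpace.somePath (α x₁) (β x₁) with hq₀
  have hcontα : Continuous fun x : ↥(α ⁻¹' Uα ∩ β ⁻¹' Uβ) ↦ sα (α x) :=
    (hsα.comp_continuous (α.continuous.comp continuous_subtype_val) fun x ↦ x.2.1)
  have hcontβ : Continuous fun x : ↥(α ⁻¹' Uα ∩ β ⁻¹' Uβ) ↦ sβ (β x) :=
    (hsβ.comp_continuous (β.continuous.comp continuous_subtype_val) fun x ↦ x.2.2)
  refine ⟨⟨fun y ↦ q₀ y.2 + proj Φ ((1 - (y.2 : ℝ)) • (sα (α y.1) - sα (α x₁)) + (y.2 : ℝ) • (sβ (β y.1) - sβ (β x₁))), ?_⟩,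
    ?_, ?_⟩
  · refine (q₀.continuous.comp continuous_snd).add ((continuous_proj Φ).comp ?_)
    refine ((continuous_const.sub (continuous_subtype_val.comp continuous_snd)).smul
      ((hcontα.comp continuous_fst).sub continuous_const)).add
      ((continuous_subtype_val.comp continuous_snd).smul ((hcontβ.comp continuous_fst).sub continuous_const))
  · intro x
    change q₀ 0 + proj Φ ((1 - ((0 : unitInterval) : ℝ)) • (sα (α x) - sα (α x₁)) +
      ((0 : unitInterval) : ℝ) • (sβ (β x) - sβ (β x₁))) = α x
    rw [q₀.source, Set.Icc.coe_zero, sub_zero, one_smul, zero_smul, add_zero, proj_sub, hpsα, hpsα]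
    abel
  · intro x
    change q₀ 1 + proj Φ ((1 - ((1 : unitInterval) : ℝ)) • (sα (α x) - sα (α x₁)) +
      ((1 : unitInterval) : ℝ) • (sβ (β x) - sβ (β x₁))) = β x
    rw [q₀.target, Set.Icc.coe_one, sub_self, zero_smul, one_smul, zero_add, proj_sub, hpsβ, hpsβ]
    abel

/-! ### The theorem: torsion readings against a flat frame are constant -/

variable {E F : Type} [TopologicalSpace E] [T2Space E] [TopologicalSpace F]

omit [Fintype ι] in
/-- An integer vector projects to `0` in `(ℝ/ℤ)^ι`. [cite: Lange2023AbelianVarietiesComplex, §1.1.3 (pp. 13–14)] -/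
theorem proj_intCast (w : ι → ℤ) : proj Φ (fun i ↦ (w i : ℝ)) = 0 := by
  funext i
  rw [proj_apply]
  change ((w i : ℝ) : AddCircle (1 : ℝ)) = 0
  rw [AddCircle.coe_eq_zero_iff]
  exact ⟨w i, by rw [zsmul_eq_mul, mul_one]⟩

omit [Fintype ι] in
/-- `N • [w/N] = 0` in `(ℝ/ℤ)^ι` for `N ≥ 1`. [cite: Lange2023AbelianVarietiesComplex, §1.1.3 (pp. 13–14)] -/
theorem nsmul_proj_div_eq_zero (N : ℕ) (hN : 0 < N) (w : ι → ℤ) : N • proj Φ (fun i ↦ (w i : ℝ) / N) = 0 := by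
  have h : N • proj Φ (fun i ↦ (w i : ℝ) / N) = proj Φ (fun i ↦ (w i : ℝ)) := by
    funext i
    change N • (proj Φ (fun i ↦ (w i : ℝ) / N)) i = proj Φ (fun i ↦ (w i : ℝ)) i
    rw [proj_apply, proj_apply, ← AddCircle.coe_nsmul, nsmul_eq_mul]
    have hN' : (N : ℝ) ≠ 0 := by exact_mod_cast hN.ne'
    rw [mul_div_cancel₀ _ hN']
  rw [h, proj_intCast]

/-- **TORSION READINGS AGAINST A FLAT FRAME ARE CONSTANT.**  Let `p : E → B` be trivialised by `triv : B × F ≃ₜ E` over a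
path-connected base, every fibre `p⁻¹(x)` charted by a torus `u x : (ℝ/ℤ)^ι → E` (continuous, injective, onto the fibre — NO
continuity in `x`), `nE` a continuous self-map of `E` which is multiplication by `N ≥ 1` in every chart, `Ξₐ ∈ H¹(E; R)` global classes (any
coefficient ring `R` of characteristic `0`) pulling back to the canonical classes `ξₐ = (t ↦ tₐ)^*θ` in every chart (the flat frame), `z` the (continuous) zero section and `τ` a continuous section
reading `[w(x)/N]` in the chart at `x`.  Then `w(x) ≡ w(x′) (mod N)` for all `x, x′`. [cite: VoisinHodgeI2002, §9.2.1 (pp. 229–231)]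
[cite: HatcherAT2002, Prop. 1.30 (p. 60) and §3.1 p. 201] [cite: LangeBirkenhake1992, Ch. 8 §8.1] -/
theorem torsionReading_eq_of_trivialisation (R : Type) [CommRing R] [CharZero R] [PathConnectedSpace B] (p : E → B)
    (triv : B × F ≃ₜ E)
    (htriv : ∀ y, p (triv y) = y.1) (u : B → C(ComplexTorus Φ, E)) (hpu : ∀ x t, p (u x t) = x)
    (hinj : ∀ x, Function.Injective (u x)) (hsurj : ∀ x e, p e = x → ∃ t, u x t = e)
    (N : ℕ) (hN : 0 < N) (nE : C(E, E)) (hnE : ∀ x t, nE (u x t) = u x (N • t))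
    (Ξ : ι → singularCohomology R R E 1) (hΞ : ∀ x a, singularCohomology.map R R (u x) 1 (Ξ a) =
      singularCohomology.map R R (latticeCircle Φ a) 1 (circleClass R))
    (z : C(B, E)) (hz : ∀ x, z x = u x 0) (τ : C(B, E)) (w : B → ι → ℤ)
    (hτ : ∀ x, τ x = u x (proj Φ fun i ↦ (w x i : ℝ) / N)) (x x' : B) (a : ι) :
    (w x a : ZMod N) = (w x' a : ZMod N) := by
  classical
  /- Step 0: bookkeeping — `p` of the sections, the `F`-coordinate of a point, fibre homeomorphisms `U x : T ≃ₜ p⁻¹(x)`. -/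
  have hpz : ∀ x, p (z x) = x := fun x ↦ by rw [hz, hpu]
  have hpτ : ∀ x, p (τ x) = x := fun x ↦ by rw [hτ, hpu]
  have hfst : ∀ e, (triv.symm e).1 = p e := fun e ↦ by
    conv_rhs => rw [← triv.apply_symm_apply e]
    rw [htriv]
  have htriv_snd : ∀ e, triv (p e, (triv.symm e).2) = e := fun e ↦ by
    conv_rhs => rw [← triv.apply_symm_apply e]
    rw [← hfst]
  have hU : ∀ x, ∃ Ux : ComplexTorus Φ ≃ₜ {e // p e = x}, ∀ t, (Ux t : E) = u x t := by
    intro x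
    let f : ComplexTorus Φ ≃ {e // p e = x} := Equiv.ofBijective (fun t ↦ ⟨u x t, hpu x t⟩)
      ⟨fun t t' h ↦ hinj x (congrArg Subtype.val h), fun e ↦ by
        obtain ⟨t, ht⟩ := hsurj x e.1 e.2
        exact ⟨t, Subtype.ext ht⟩⟩
    exact ⟨Continuous.homeoOfEquivCompactToT2 (f := f) ((u x).continuous.subtype_mk _), fun t ↦ rfl⟩
  choose U hUu using hU
  have hUsymm : ∀ x t, (U x).symm ⟨u x t, hpu x t⟩ = t := fun x t ↦ by
    rw [Homeomorph.symm_apply_eq]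
    exact Subtype.ext (hUu x t).symm
  /- the reading `x ↦ w(x)ₐ mod N` is locally constant, hence constant -/
  suffices hlc : IsLocallyConstant (fun x ↦ (w x a : ZMod N)) from hlc.apply_eq_of_preconnectedSpace x x'
  refine (IsLocallyConstant.iff_eventually_eq _).2 fun x₁ ↦ ?_
  /- Step 1: torus coordinates on the `x₁`-fibre transported by `triv`: `κ : T → F`, `k : F → T`. -/
  set g : C(F, {e // p e = x₁}) := ⟨fun y ↦ ⟨triv (x₁, y), htriv (x₁, y)⟩,
    (triv.continuous.comp (continuous_const.prodMk continuous_id)).subtype_mk _⟩ with hgdef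
  set k : F → ComplexTorus Φ := fun y ↦ (U x₁).symm (g y) with hkdef
  have hk : Continuous k := (U x₁).symm.continuous.comp g.continuous
  set κ : ComplexTorus Φ → F := fun t ↦ (triv.symm (u x₁ t)).2 with hκdef
  have hκ : Continuous κ := continuous_snd.comp (triv.symm.continuous.comp (u x₁).continuous)
  have hkκ : ∀ t, k (κ t) = t := fun t ↦ by
    change (U x₁).symm ⟨triv (x₁, (triv.symm (u x₁ t)).2), _⟩ = t
    rw [Homeomorph.symm_apply_eq]
    refine Subtype.ext ?_
    rw [hUu]
    change triv (x₁, (triv.symm (u x₁ t)).2) = u x₁ t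
    have h := htriv_snd (u x₁ t)
    rw [hpu] at h
    exact h
  have hκk : ∀ y, κ (k y) = y := fun y ↦ by
    change (triv.symm (u x₁ ((U x₁).symm (g y)))).2 = y
    rw [← hUu x₁, Homeomorph.apply_symm_apply]
    change (triv.symm (triv (x₁, y))).2 = y
    rw [triv.symm_apply_apply]
  have huk : ∀ y, u x₁ (k y) = triv (x₁, y) := fun y ↦ by
    rw [← hUu x₁]
    change ((U x₁) ((U x₁).symm (g y)) : E) = triv (x₁, y)
    rw [Homeomorph.apply_symm_apply]
    rfl
  /- the sections in transported torus coordinates -/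
  set zT : C(B, ComplexTorus Φ) := ⟨fun x ↦ k (triv.symm (z x)).2,
    hk.comp (continuous_snd.comp (triv.symm.continuous.comp z.continuous))⟩ with hzTdef
  set τT : C(B, ComplexTorus Φ) := ⟨fun x ↦ k (triv.symm (τ x)).2,
    hk.comp (continuous_snd.comp (triv.symm.continuous.comp τ.continuous))⟩ with hτTdef
  /- Step 2: a continuous family of fibrewise paths from the zero section to `τ`, near `x₁`. -/
  obtain ⟨B₁, hB₁o, hx₁, P, hP0, hP1⟩ := exists_nhds_pathFamily Φ zT τT x₁
  -- in `E`: `PE (x, s) = triv (x, κ (P (x, s)))`, a path in the fibre over `x` from `z x` to `τ x`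
  set PE : C(↥B₁ × unitInterval, E) := ⟨fun y ↦ triv ((y.1 : B), κ (P y)),
    triv.continuous.comp ((continuous_subtype_val.comp continuous_fst).prodMk (hκ.comp P.continuous))⟩ with hPEdef
  have hpPE : ∀ y, p (PE y) = (y.1 : B) := fun y ↦ htriv _
  have hPE0 : ∀ x : B₁, PE (x, 0) = z x := fun x ↦ by
    change triv ((x : B), κ (P (x, 0))) = z x
    rw [hP0]
    change triv ((x : B), κ (k (triv.symm (z x)).2)) = z x
    rw [hκk]
    have h := htriv_snd (z x)
    rw [hpz] at h
    exact h
  have hPE1 : ∀ x : B₁, PE (x, 1) = τ x := fun x ↦ by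
    change triv ((x : B), κ (P (x, 1))) = τ x
    rw [hP1]
    change triv ((x : B), κ (k (triv.symm (τ x)).2)) = τ x
    rw [hκk]
    have h := htriv_snd (τ x)
    rw [hpτ] at h
    exact h
  /- Step 3: the loops `L_x = nE ∘ PE_x` at `z x`, read in the transported torus coordinates: a continuous family. -/
  have hnEz : ∀ x, nE (z x) = z x := fun x ↦ by rw [hz, hnE, smul_zero]
  have hnEτ : ∀ x, nE (τ x) = z x := fun x ↦ by rw [hτ, hnE, nsmul_proj_div_eq_zero Φ N hN, hz]
  set ℓ : C(↥B₁ × unitInterval, ComplexTorus Φ) := ⟨fun y ↦ k (triv.symm (nE (PE y))).2,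
    hk.comp (continuous_snd.comp (triv.symm.continuous.comp (nE.continuous.comp PE.continuous)))⟩ with hℓdef
  have hℓ01 : ∀ x : B₁, ℓ (x, 0) = ℓ (x, 1) := fun x ↦ by
    change k (triv.symm (nE (PE (x, 0)))).2 = k (triv.symm (nE (PE (x, 1)))).2
    rw [hPE0, hPE1, hnEz, hnEτ]
  let γ : ∀ x : B₁, Path (ℓ (x, 0)) (ℓ (x, 0)) := fun x ↦
    { toFun := fun s ↦ ℓ (x, s)
      continuous_toFun := ℓ.continuous.comp (continuous_const.prodMk continuous_id)
      source' := rfl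
      target' := (hℓ01 x).symm }
  have hγ : ∀ x s, γ x s = ℓ (x, s) := fun _ _ ↦ rfl
  -- windings of the family are locally constant at `x₁`
  have hloc := exists_nhds_windingCochain_eq Φ a ℓ hℓ01 γ hγ ⟨x₁, hx₁⟩
  /- Step 4: for EVERY `x ∈ B₁`, the `a`-th winding of `γ x` is `w(x)ₐ (mod N)`. -/
  have hread : ∀ x : B₁, ((windingCochain (ofPath ((γ x).map (latticeCircle Φ a).continuous)) : ZMod N)) = w x a := by
    intro x
    -- the path `q_x = (u x)⁻¹ ∘ PE_x` in the chart at `x`, from `0` to `[w(x)/N]`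
    have hmem : ∀ s, p (PE (x, s)) = x := fun s ↦ hpPE _
    let q : Path (0 : ComplexTorus Φ) (proj Φ fun i ↦ (w x i : ℝ) / N) :=
      { toFun := fun s ↦ (U x).symm ⟨PE (x, s), hmem s⟩
        continuous_toFun := (U x).symm.continuous.comp
          ((PE.continuous.comp (continuous_const.prodMk continuous_id)).subtype_mk _)
        source' := by
          have h : (⟨PE (x, 0), hmem 0⟩ : {e // p e = x}) = ⟨u x 0, hpu x 0⟩ :=
            Subtype.ext (by change PE (x, 0) = u x 0; rw [hPE0, hz])
          rw [h, hUsymm]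
        target' := by
          have h : (⟨PE (x, 1), hmem 1⟩ : {e // p e = x}) =
              ⟨u x (proj Φ fun i ↦ (w x i : ℝ) / N), hpu x _⟩ :=
            Subtype.ext (by change PE (x, 1) = u x _; rw [hPE1, hτ])
          rw [h, hUsymm] }
    have huq : ∀ s, u x (q s) = PE (x, s) := fun s ↦ by
      change u x ((U x).symm ⟨PE (x, s), hmem s⟩) = PE (x, s)
      rw [← hUu x, Homeomorph.apply_symm_apply]
    -- the loop `λ_x = N • q_x` at `0`, which `u x` carries to `L_x`
    let lam : Path (0 : ComplexTorus Φ) 0 :=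
      { toFun := fun s ↦ N • q s
        continuous_toFun := (continuous_nsmul N).comp q.continuous
        source' := by rw [q.source, smul_zero]
        target' := by rw [q.target, nsmul_proj_div_eq_zero Φ N hN] }
    have hlam : ∀ s, lam s = N • q s := fun _ ↦ rfl
    have hulam : ∀ s, u x (lam s) = nE (PE (x, s)) := fun s ↦ by rw [hlam, ← hnE, huq]
    -- reading in the chart at `x`: `ϑ((λ_x)ₐ) ≡ w(x)ₐ`
    have h1 := windingCochain_nsmul_path_of_torsion Φ a N hN (w x) q lam hlam
    -- the transported chart `m = k ∘ pr₂ ∘ triv⁻¹ ∘ u x` carries `λ_x` to `γ x`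
    set m : C(ComplexTorus Φ, ComplexTorus Φ) := ⟨fun t ↦ k (triv.symm (u x t)).2,
      hk.comp (continuous_snd.comp (triv.symm.continuous.comp (u x).continuous))⟩ with hmdef
    have hℓm : ℓ (x, 0) = m 0 := by
      change k (triv.symm (nE (PE (x, 0)))).2 = k (triv.symm (u x 0)).2
      rw [hPE0, hnEz, hz]
    have hγm : loopClass R R (1 : R) (γ x) = singularHomology.map R R m 1 (loopClass R R (1 : R) lam) := by
      rw [map_loopClass]
      have e : γ x = (lam.map m.continuous).cast hℓm hℓm := by
        ext s
        change k (triv.symm (nE (PE (x, s)))).2 = k (triv.symm (u x (lam s))).2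
        rw [hulam]
      rw [e]
      rfl
    -- `m^* ξₐ = ξₐ`: both `u x` and `u x₁ ∘ m` are `triv (·, c t)` over the endpoints of a path `x₁ ⇝ x`
    have hm : singularCohomology.map R R m 1 (singularCohomology.map R R (latticeCircle Φ a) 1 (circleClass R)) =
        singularCohomology.map R R (latticeCircle Φ a) 1 (circleClass R) := by
      set c : C(ComplexTorus Φ, F) := ⟨fun t ↦ (triv.symm (u x t)).2,
        continuous_snd.comp (triv.symm.continuous.comp (u x).continuous)⟩ with hcdef
      have hux : u x = ⟨fun t ↦ triv ((x : B), c t), triv.continuous.comp (continuous_const.prodMk c.continuous)⟩ := by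
        ext t
        change u x t = triv ((x : B), (triv.symm (u x t)).2)
        conv_lhs => rw [← htriv_snd (u x t), hpu]
      have hum : (u x₁).comp m = ⟨fun t ↦ triv (x₁, c t), triv.continuous.comp (continuous_const.prodMk c.continuous)⟩ := by
        ext t
        exact huk _
      -- the homotopy `(s, t) ↦ triv (ω s, c t)` along a path `ω : x₁ ⇝ x`
      let ω : Path x₁ (x : B) := PathConnectedSpace.somePath x₁ x
      have hhom : ContinuousMap.Homotopic
          (⟨fun t ↦ triv (x₁, c t), triv.continuous.comp (continuous_const.prodMk c.continuous)⟩ :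
            C(ComplexTorus Φ, E))
          ⟨fun t ↦ triv ((x : B), c t), triv.continuous.comp (continuous_const.prodMk c.continuous)⟩ :=
        ⟨{ toFun := fun y ↦ triv (ω y.1, c y.2)
           continuous_toFun := triv.continuous.comp ((ω.continuous.comp continuous_fst).prodMk
             (c.continuous.comp continuous_snd))
           map_zero_left := fun t ↦ by change triv (ω 0, c t) = triv (x₁, c t); rw [ω.source]
           map_one_left := fun t ↦ by change triv (ω 1, c t) = triv ((x : B), c t); rw [ω.target] }⟩
      calc singularCohomology.map R R m 1 (singularCohomology.map R R (latticeCircle Φ a) 1 (circleClass R))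
          = singularCohomology.map R R m 1 (singularCohomology.map R R (u x₁) 1 (Ξ a)) := by rw [hΞ x₁]
        _ = singularCohomology.map R R ((u x₁).comp m) 1 (Ξ a) := by
            rw [singularCohomology.map_comp]; rfl
        _ = singularCohomology.map R R (u x) 1 (Ξ a) := by
            rw [hum, hux, singularCohomology.map_eq_of_homotopic_holds R R hhom 1]
        _ = singularCohomology.map R R (latticeCircle Φ a) 1 (circleClass R) := hΞ x a
    -- assemble: `⟨ξₐ, h(γ x)⟩ = ⟨m^* ξₐ, h(λ_x)⟩ = ⟨ξₐ, h(λ_x)⟩`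
    have h2 : (windingCochain (ofPath ((γ x).map (latticeCircle Φ a).continuous)) : R) =
        (windingCochain (ofPath (lam.map (latticeCircle Φ a).continuous)) : R) := by
      rw [← kroneckerPairing_latticeCircle_loopClass Φ R, ← kroneckerPairing_latticeCircle_loopClass Φ R, hγm,
        ← kroneckerPairing_map, hm]
    have h3 : windingCochain (ofPath ((γ x).map (latticeCircle Φ a).continuous)) =
        windingCochain (ofPath (lam.map (latticeCircle Φ a).continuous)) := by exact_mod_cast h2
    rw [h3, h1]
  /- Step 5: combine — near `x₁` (inside `B₁`) the winding of `γ x` is that of `γ x₁`. -/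
  have hloc' : ∀ᶠ y in 𝓝 x₁, ∃ hy : y ∈ B₁, windingCochain (ofPath ((γ ⟨y, hy⟩).map (latticeCircle Φ a).continuous)) =
      windingCochain (ofPath ((γ ⟨x₁, hx₁⟩).map (latticeCircle Φ a).continuous)) := by
    have h := (eventually_nhds_subtype_iff B₁ ⟨x₁, hx₁⟩ (fun y ↦ ∃ hy : y ∈ B₁,
      windingCochain (ofPath ((γ ⟨y, hy⟩).map (latticeCircle Φ a).continuous)) =
        windingCochain (ofPath ((γ ⟨x₁, hx₁⟩).map (latticeCircle Φ a).continuous)))).1 ?_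
    · rwa [nhdsWithin_eq_nhds.2 (hB₁o.mem_nhds hx₁)] at h
    · filter_upwards [hloc] with y hy
      exact ⟨y.2, hy⟩
  filter_upwards [hloc'] with y hy
  obtain ⟨hyB, hwind⟩ := hy
  rw [← hread ⟨y, hyB⟩, ← hread ⟨x₁, hx₁⟩, hwind]

end ComplexTorus

end Literature.Geometry.Kaehler

end
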